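import Summits.BirchSwinnertonDyer.Rank1Residual.WAll.TargetCMTwoRamifiedBookedIsogeny
import Literature.NumberTheory.QuadraticFields.RedeiMatrixFourRank
import HarnessLib
import HarnessLib.Audit.Tags

/-!
# Rung W-ALL of ladder BSD (D-0120) — the ramified slice of row 12₂: THE FOUR-PRIME THETA-DESCENT FAMILY OF CELL
# `bsd-monsky` (prover-B, type `(3,5,5,5)` with `g(n)` odd: `n = 2p₁p₂p₃p₄`) CARVED OUT OF THE ISOGENY-CLASS RESIDUAL,
# BY NAME (cell `bsd-print-cf2`, D-0131 (2) PRINT TIER, seat p1 = lead of crux stmt-BirchSwinnertonDyer-20509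
# `RamifiedOffTYZOfFacts` of route `PrintCf2`)

HONEST FRAMING (cell `bsd-print-cf2`, run/shared/lean/pub/bsd-print-cf2/; partition leaf «CornerF @ `p = 2`» =
`Summit.BirchSwinnertonDyer.WAllCornerFTwo`, OPEN AS A CLASS): STATEMENTS AND BOOKKEEPING ONLY — nothing asserted,
nothing booked, no named fact introduced, no published theorem restated. After the isogeny saturation of the five booked
congruent-number families (`WAll/TargetCMTwoRamifiedBookedIsogeny.lean`, this seat) the named residual of crux 20509 is
`WAllCornerFTwoRamifiedOffBookedIsogeny` («CM, `r_an = 1`, `2 ∣ d_K`, isogenous to NO booked `E_n` and to NO Shu–Zhai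
twist of `256c1`»). It still contains ONE explicit infinite family on which the tree PROVES
`ord_{s=1} L(E_n, s) = 1 ∧ rank 1 ∧ Ш(E_n)[2^∞] = 0 ∧ BSD(E_n, 2)`: the FOUR-PRIME theta-descent family of cell
`bsd-monsky` (prover-B, `P2.ThetaDescent.rankOne_sha_bsdp_two_two_mul_3555_family_of_aoki`, file
`P2/CongruentNumberThetaFourPrimesBSD.lean`): `n = 2p₁p₂p₃p₄`, `p₁ ≡ 3`, `p₂ ≡ p₃ ≡ p₄ ≡ 5 (mod 8)` distinct, and the
number of pairs of `−1`-symbols among `(p₂/p₁), (p₃/p₁), (p₄/p₁), (p₃/p₂), (p₄/p₂), (p₄/p₃)` sharing a prime EVEN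
(⟺ `g(n) = #2Cl(ℚ(√−n))` odd, Rédei–Reichardt) — smallest member `11310 = 2·3·5·13·29`, a cell on which TYZ Thm 1.2 is
SILENT (it lies outside `CongruentTYZUPlusFamily`) and outside every `k ≤ 3` shape of `CongruentThetaFamily`. The tree
theorem is relative to {`tyz_cmPointGaloisData`, TYZ Thm 1.1, GZK} and a `2`-Selmer count — Aoki 1999 Thm 2.2 in the
cited file; the Theorems-side closer of THIS leaf re-runs it on Heath-Brown 1994's even count (conjunct 10 of `𝔅_ram`,
moreover the tree theorem `monsky_card_selmerGroup_two_even_holds`), so that the leaf closes from EXACTLY the antecedent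
of the closed aside 21185 `RamifiedThetaOfFactsPlus` (`𝔅_ram ∧ thm11_parity_of_scriptL ∧ tyz_cmPointGaloisData`):
booking currency LITERAL-by-name(hCM), as aside 21185. This file NAMES the family and carves it out, in ISOGENY-CLASS
currency from the start:

* §1 `CongruentThetaFourFamily` (VERBATIM the hypotheses of the family theorem, membership up to `ℚ`-isomorphism) and
  `CongruentThetaFourIsogenyClass W` (its `ℚ`-isogeny closure);
* §2 the leaf `WAllCornerFTwoRamifiedThetaFour` (ON the isogeny classes of the family) and the residual
  `WAllCornerFTwoRamifiedOffBookedIsogenyOffThetaFour` (the isogeny-class residual with this family carved out as well);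
* §3 membership facts (square-free EVEN parameter ⇒ CM by `ℤ[i]`, `2` ramified; isogeny members likewise);
* §4 glue, EXACT: `WAllCornerFTwoRamifiedOffBookedIsogeny` ⟺ (its four-prime part) ∧ the new residual; the composition
  `wAllCornerFTwoRamifiedOffTYZProved_of_bookedIsogeny_of_shuZhai_of_thetaFour_of_off` (crux 20509's conclusion from
  FOUR leaves) for the lead's skeleton; the four-way cut of the ramified slice; restrictions from row 12₂.
The closer lands in `Summits/BirchSwinnertonDyer/BirchSwinnertonDyer/Theorems/PrintCf2RamifiedOffTYZThetaFourLeaf.lean`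
(seat p1); the planner files the `…OfFactsPlus` aside (TURNKEY there).

WHY (seat p1, strategy «Tian–Yuan–Zhang induction BY NAME: Heegner points + genus theory + Gross–Zagier/Waldspurger ⇒
2-part of BSD for `E_n` with controlled prime factorisations … typed as class theorems on explicit infinite families»):
an explicit infinite family with controlled prime factorisation on which BSD(E,2) follows from TYZ's CM-point framework
(Thm 1.1 for the auxiliary twists, Thm 3.5/3.6) plus a 2-descent count, BEYOND PRINT (Monsky 1990 p. 67 Remark (3)
conjectures the two-prime case only; Tian–Yuan–Zhang's criterion is silent on part of the family).

References: `WAll/TargetCMTwoRamifiedBookedIsogeny.lean` (this seat), `WAll/TargetCMTwoRamifiedTheta.lean` (p548609),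
`P2/CongruentNumberThetaFourPrimes{,Family,SelmerCfg,BSD}.lean` (cell `bsd-monsky`, prover-B),
`Literature/…/QuadraticFields/RedeiMatrixFourRank.lean` (`kroneckerBit`). [cite: Monsky1990MockHeegner, p. 67 Remark (3)]
[cite: TianYuanZhang2017, Thm. 1.1, §1 (1.1), Thm. 3.5, Thm. 3.6] [cite: HeathBrown1994SelmerCongruentII, Appendix
(Monsky), typescript p. 41 L20–L36] [cite: Aoki1999, Thm. 2.2 (p. 81)] [cite: Miller2011LMS, §1 and Def. 1.1]
[cite: MilneADT2006, Thm. I.7.3].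
-/

noncomputable section

open scoped Classical

open WeierstrassCurve Literature.NumberTheory.EllipticCurves
  Literature.NumberTheory.EllipticCurves.Rank1Residual
open Literature.NumberTheory.QuadraticFields.RedeiReichardt (kroneckerBit)
open Summit.BirchSwinnertonDyer.Rank1Residual

set_option autoImplicit false

namespace Summit.BirchSwinnertonDyer

/-! ### §1. Membership predicates: the four-prime theta family and its `ℚ`-isogeny closure -/

/-- **The four-prime theta-descent family of cell `bsd-monsky` (type `(3,5,5,5)`, `g(n)` odd)** as a class at `2`: `W`
is a `ℚ`-model of `E_n`, `n = 2p₁p₂p₃p₄`, with `p₁ ≡ 3`, `p₂ ≡ p₃ ≡ p₄ ≡ 5 (mod 8)` primes, `p₂, p₃, p₄` distinct, and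
the sum over the pairs sharing a prime of the products of the `−1`-bits of `(p₂/p₁), (p₃/p₁), (p₄/p₁), (p₃/p₂), (p₄/p₂),
(p₄/p₃)` equal to `0` in `ZMod 2` (⟺ `g(n)` odd) — VERBATIM the hypotheses of
`P2.ThetaDescent.rankOne_sha_bsdp_two_two_mul_3555_family_of_aoki`. A predicate; nothing asserted.
[cite: TianYuanZhang2017, Thm. 1.1, Thm. 3.5, §1 (g(d))] [cite: Monsky1990MockHeegner, p. 67 Remark (3)] -/
def CongruentThetaFourFamily : P2.ClassAtTwo := fun W _ _ =>
  ∃ p₁ p₂ p₃ p₄ : ℕ, p₁.Prime ∧ p₂.Prime ∧ p₃.Prime ∧ p₄.Prime ∧ p₁ % 8 = 3 ∧ p₂ % 8 = 5 ∧ p₃ % 8 = 5 ∧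
    p₄ % 8 = 5 ∧ p₂ ≠ p₃ ∧ p₂ ≠ p₄ ∧ p₃ ≠ p₄ ∧
    kroneckerBit p₂ p₁ * kroneckerBit p₃ p₁ + kroneckerBit p₂ p₁ * kroneckerBit p₄ p₁ +
        kroneckerBit p₂ p₁ * kroneckerBit p₃ p₂ + kroneckerBit p₂ p₁ * kroneckerBit p₄ p₂ +
        kroneckerBit p₃ p₁ * kroneckerBit p₄ p₁ + kroneckerBit p₃ p₁ * kroneckerBit p₃ p₂ +
        kroneckerBit p₃ p₁ * kroneckerBit p₄ p₃ + kroneckerBit p₄ p₁ * kroneckerBit p₄ p₂ +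
        kroneckerBit p₄ p₁ * kroneckerBit p₄ p₃ + kroneckerBit p₃ p₂ * kroneckerBit p₄ p₂ +
        kroneckerBit p₃ p₂ * kroneckerBit p₄ p₃ + kroneckerBit p₄ p₂ * kroneckerBit p₄ p₃ = 0 ∧
    ∃ C : VariableChange ℚ, C • congruentNumberCurve (2 * (p₁ * p₂ * p₃ * p₄)) = W

/-- **`W` lies in the `ℚ`-isogeny class of a member of the four-prime theta family** (so: the member `E_n` itself, its
`j = 1728` partner `y² = x³ + (n/2)²x`, both `j = 287496` partners). A definition with a body (data `W₀`), not a named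
fact; nothing asserted. [cite: CremonaAlgorithms1997, §3.8 and Table 1 (class 32a)] -/
def CongruentThetaFourIsogenyClass (W : WeierstrassCurve ℚ) : Prop :=
  ∃ (W₀ : WeierstrassCurve ℚ) (_ : W₀.IsElliptic) (_ : W₀.IsGloballyMinimal),
    IsIsogenous W W₀ ∧ CongruentThetaFourFamily W₀

/-! ### §2. Leaves: the four-prime theta slice (isogeny classes) and the residual off it -/

/-- **Ramified slice ON THE ISOGENY CLASSES OF THE FOUR-PRIME THETA FAMILY** (closed BEYOND `𝔅_ram` by
`PrintCf2.wAllCornerFTwoRamifiedThetaFour_of_facts (hCM) (h11) (hGZK) (hCAS) (hMOD)`: TYZ §3 CM-point display, TYZ Thm 1.1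
as printed, GZK, Cassels, modularity; Heath-Brown 1994's even count being a tree theorem): CM, `ord_{s=1} L(E,s) = 1`,
`2 ∣ d_K`, `W` isogenous to a member ⇒ `BSD(E,2)`. [folklore] -/
@[conjecture] def WAllCornerFTwoRamifiedThetaFour : Prop :=
  ∀ (W : WeierstrassCurve ℚ) [W.IsElliptic] [W.IsGloballyMinimal],
    W.HasCM → W.analyticRank = 1 → CMRamified W 2 → CongruentThetaFourIsogenyClass W → BSDp W 2

/-- **THE RESIDUAL OF CRUX 20509 IN ISOGENY-CLASS CURRENCY, OFF THE FOUR-PRIME THETA FAMILY TOO (OPEN)**: CM,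
`ord_{s=1} L(E,s) = 1`, `2 ∣ d_K`, and `W` is `ℚ`-isogenous to NO member of the five booked congruent-number families,
to NO Shu–Zhai twist of `256c1`, and to NO member of the four-prime theta family ⇒ `BSD(E,2)`. No theorem in print.
[folklore] -/
@[conjecture] def WAllCornerFTwoRamifiedOffBookedIsogenyOffThetaFour : Prop :=
  ∀ (W : WeierstrassCurve ℚ) [W.IsElliptic] [W.IsGloballyMinimal],
    W.HasCM → W.analyticRank = 1 → CMRamified W 2 →
      ¬ CongruentBookedIsogenyClass W → ¬ P2.IsIsogenousToShuZhaiTwoFiftySixTwist W →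
      ¬ CongruentThetaFourIsogenyClass W → BSDp W 2

/-! ### §3. Membership facts -/

/-- The parameter `2p₁p₂p₃p₄` of a member is square-free (four distinct odd primes: `p₁ ≡ 3`, the others `≡ 5 (mod 8)`).
[folklore] -/
theorem squarefree_of_thetaFour {p₁ p₂ p₃ p₄ : ℕ} (hp₁ : p₁.Prime) (hp₂ : p₂.Prime) (hp₃ : p₃.Prime)
    (hp₄ : p₄.Prime) (h₁ : p₁ % 8 = 3) (h₂ : p₂ % 8 = 5) (h₃ : p₃ % 8 = 5) (h₄ : p₄ % 8 = 5) (h23 : p₂ ≠ p₃)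
    (h24 : p₂ ≠ p₄) (h34 : p₃ ≠ p₄) : Squarefree (2 * (p₁ * p₂ * p₃ * p₄)) := by
  have cop : ∀ {a b : ℕ}, a.Prime → b.Prime → a ≠ b → a.Coprime b :=
    fun ha hb hab => (Nat.coprime_primes ha hb).mpr hab
  have h12 : p₁ ≠ p₂ := fun h => by omega
  have h13 : p₁ ≠ p₃ := fun h => by omega
  have h14 : p₁ ≠ p₄ := fun h => by omega
  have h2 : (2 : ℕ).Coprime (p₁ * p₂ * p₃ * p₄) :=
    Nat.Coprime.mul_right
      (Nat.Coprime.mul_right (Nat.Coprime.mul_right (cop Nat.prime_two hp₁ (by omega)) (cop Nat.prime_two hp₂ (by omega)))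
        (cop Nat.prime_two hp₃ (by omega)))
      (cop Nat.prime_two hp₄ (by omega))
  refine Nat.squarefree_mul_iff.mpr ⟨h2, Nat.prime_two.squarefree, ?_⟩
  refine Nat.squarefree_mul_iff.mpr
    ⟨Nat.Coprime.mul_left (Nat.Coprime.mul_left (cop hp₁ hp₄ h14) (cop hp₂ hp₄ h24)) (cop hp₃ hp₄ h34), ?_, hp₄.squarefree⟩
  refine Nat.squarefree_mul_iff.mpr ⟨Nat.Coprime.mul_left (cop hp₁ hp₃ h13) (cop hp₂ hp₃ h23), ?_, hp₃.squarefree⟩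
  exact Nat.squarefree_mul_iff.mpr ⟨cop hp₁ hp₂ h12, hp₁.squarefree, hp₂.squarefree⟩

/-- **Every member of `CongruentThetaFourFamily` is a `ℚ`-model of `E_n` with `n` square-free and EVEN.** [folklore] -/
theorem exists_smul_congruentNumberCurve_even_of_congruentThetaFourFamily {W : WeierstrassCurve ℚ} [W.IsElliptic]
    [W.IsGloballyMinimal] (h : CongruentThetaFourFamily W) :
    ∃ n : ℕ, Squarefree n ∧ n % 2 = 0 ∧ ∃ C : VariableChange ℚ, C • congruentNumberCurve n = W := by
  obtain ⟨p₁, p₂, p₃, p₄, hp₁, hp₂, hp₃, hp₄, h₁, h₂, h₃, h₄, h23, h24, h34, -, C, hC⟩ := h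
  exact ⟨_, squarefree_of_thetaFour hp₁ hp₂ hp₃ hp₄ h₁ h₂ h₃ h₄ h23 h24 h34, by omega, C, hC⟩

/-- Every member of `CongruentThetaFourFamily` has CM by `ℤ[i]` with `2` ramified (`j = 1728`). [folklore] -/
theorem hasCM_and_cmRamified_two_of_congruentThetaFourFamily {W : WeierstrassCurve ℚ} [W.IsElliptic]
    [W.IsGloballyMinimal] (h : CongruentThetaFourFamily W) : W.HasCM ∧ CMRamified W 2 := by
  obtain ⟨n, hsq, -, C, hC⟩ := exists_smul_congruentNumberCurve_even_of_congruentThetaFourFamily h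
  exact hasCM_and_cmRamified_two_of_smul_congruentNumberCurve hsq.ne_zero hC

/-- A model member of the four-prime family is an isogeny member (`W₀ := W`). [folklore] -/
theorem congruentThetaFourIsogenyClass_of_congruentThetaFourFamily {W : WeierstrassCurve ℚ} [W.IsElliptic]
    [W.IsGloballyMinimal] (h : CongruentThetaFourFamily W) : CongruentThetaFourIsogenyClass W :=
  ⟨W, ‹_›, ‹_›, isIsogenous_self W, h⟩

/-- **The isogeny classes of the four-prime family lie in the ramified slice** (CM and the CM type are `ℚ`-isogeny
invariants). [cite: SilvermanAdvancedTopics1994, Exercise 2.12(b) and App. A §3 (p. 483)] -/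
theorem hasCM_and_cmRamified_two_of_congruentThetaFourIsogenyClass {W : WeierstrassCurve ℚ} [W.IsElliptic]
    (h : CongruentThetaFourIsogenyClass W) : W.HasCM ∧ CMRamified W 2 := by
  obtain ⟨W₀, _, _, hiso, hF⟩ := h
  obtain ⟨hCM₀, hram₀⟩ := hasCM_and_cmRamified_two_of_congruentThetaFourFamily hF
  have hCM : W.HasCM := (X12.hasCM_iff_of_isIsogenous hiso).mpr hCM₀
  exact ⟨hCM, (X12.cmRamified_iff_of_isIsogenous hiso hCM 2).mpr hram₀⟩

/-- **The four-prime family is disjoint from the proved TYZ families** (even vs. odd square-free parameter). [folklore] -/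
theorem not_congruentTYZProvedFamily_of_congruentThetaFourFamily {W : WeierstrassCurve ℚ} [W.IsElliptic]
    [W.IsGloballyMinimal] (h : CongruentThetaFourFamily W) : ¬ CongruentTYZProvedFamily W := by
  intro hP
  obtain ⟨n, hsq, hn2, C, hC⟩ := exists_smul_congruentNumberCurve_even_of_congruentThetaFourFamily h
  obtain ⟨m', hm', hm2, C', hC'⟩ := exists_smul_congruentNumberCurve_odd_of_congruentTYZProvedFamily hP
  have h := P2.CornerFTwo.Atlas.eq_of_smul_congruentNumberCurve hsq hm' hC hC'
  omega

/-! ### §4. Glue (excluded middle on membership only; every cut exact) -/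

/-- **The isogeny-class residual ⟺ (its four-prime theta part) ∧ the residual off the four-prime family** (EXACT; pure
logic). [folklore] -/
theorem wAllCornerFTwoRamifiedOffBookedIsogeny_iff_onThetaFour_off :
    WAllCornerFTwoRamifiedOffBookedIsogeny ↔
      (∀ (W : WeierstrassCurve ℚ) [W.IsElliptic] [W.IsGloballyMinimal],
          W.HasCM → W.analyticRank = 1 → CMRamified W 2 → ¬ CongruentBookedIsogenyClass W →
            ¬ P2.IsIsogenousToShuZhaiTwoFiftySixTwist W → CongruentThetaFourIsogenyClass W → BSDp W 2) ∧
      WAllCornerFTwoRamifiedOffBookedIsogenyOffThetaFour := by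
  constructor
  · intro h
    exact ⟨fun W _ _ hcm hr1 hram h1 h2 _ ↦ h W hcm hr1 hram h1 h2,
      fun W _ _ hcm hr1 hram h1 h2 _ ↦ h W hcm hr1 hram h1 h2⟩
  · rintro ⟨hT, hO⟩ W _ _ hcm hr1 hram h1 h2
    by_cases h3 : CongruentThetaFourIsogenyClass W
    · exact hT W hcm hr1 hram h1 h2 h3
    · exact hO W hcm hr1 hram h1 h2 h3

/-- **The isogeny-class residual from the four-prime theta leaf and the residual off it** (the reduction used by the
lead's skeleton of crux 20509). [folklore] -/
theorem wAllCornerFTwoRamifiedOffBookedIsogeny_of_thetaFour_of_off (hT : WAllCornerFTwoRamifiedThetaFour)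
    (hO : WAllCornerFTwoRamifiedOffBookedIsogenyOffThetaFour) : WAllCornerFTwoRamifiedOffBookedIsogeny :=
  wAllCornerFTwoRamifiedOffBookedIsogeny_iff_onThetaFour_off.2 ⟨fun W _ _ hcm hr1 hram _ _ h3 ↦ hT W hcm hr1 hram h3, hO⟩

/-- The residual off the four-prime family is a restriction of the isogeny-class residual. [folklore] -/
theorem wAllCornerFTwoRamifiedOffBookedIsogenyOffThetaFour_of_offBookedIsogeny
    (h : WAllCornerFTwoRamifiedOffBookedIsogeny) : WAllCornerFTwoRamifiedOffBookedIsogenyOffThetaFour :=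
  (wAllCornerFTwoRamifiedOffBookedIsogeny_iff_onThetaFour_off.1 h).2

/-- **Crux 20509's conclusion from FOUR leaves** — booked-isogeny leaf, Shu–Zhai `256c1` leaf, four-prime theta leaf
and the residual off all of them (excluded middle only). [folklore] -/
theorem wAllCornerFTwoRamifiedOffTYZProved_of_bookedIsogeny_of_shuZhai_of_thetaFour_of_off
    (hI : WAllCornerFTwoRamifiedBookedIsogeny) (hZ : WAllCornerFTwoRamifiedShuZhaiTwoFiftySix)
    (hT : WAllCornerFTwoRamifiedThetaFour) (hO : WAllCornerFTwoRamifiedOffBookedIsogenyOffThetaFour) :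
    WAllCornerFTwoRamifiedOffTYZProved :=
  wAllCornerFTwoRamifiedOffTYZProved_of_bookedIsogeny_of_shuZhai_of_off hI hZ
    (wAllCornerFTwoRamifiedOffBookedIsogeny_of_thetaFour_of_off hT hO)

/-- **The ramified slice of row 12₂ ⟺ booked-isogeny ∧ Shu–Zhai `256c1` ∧ four-prime theta ∧ the residual off them**
(EXACT). [folklore] -/
theorem wAllCornerFTwoRamified_iff_bookedIsogeny_shuZhai_thetaFour_off :
    WAllCornerFTwoRamified ↔
      WAllCornerFTwoRamifiedBookedIsogeny ∧ WAllCornerFTwoRamifiedShuZhaiTwoFiftySix ∧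
        WAllCornerFTwoRamifiedThetaFour ∧ WAllCornerFTwoRamifiedOffBookedIsogenyOffThetaFour := by
  rw [wAllCornerFTwoRamified_iff_bookedIsogeny_shuZhai_off]
  constructor
  · rintro ⟨hI, hZ, hO⟩
    exact ⟨hI, hZ, fun W _ _ hcm hr1 hram _ ↦
        wAllCornerFTwoRamified_iff_bookedIsogeny_shuZhai_off.2 ⟨hI, hZ, hO⟩ W hcm hr1 hram,
      wAllCornerFTwoRamifiedOffBookedIsogenyOffThetaFour_of_offBookedIsogeny hO⟩
  · rintro ⟨hI, hZ, hT, hO⟩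
    exact ⟨hI, hZ, wAllCornerFTwoRamifiedOffBookedIsogeny_of_thetaFour_of_off hT hO⟩

/-- The four-prime theta leaf is a restriction of the ramified slice … [folklore] -/
theorem wAllCornerFTwoRamifiedThetaFour_of_wAllCornerFTwoRamified (h : WAllCornerFTwoRamified) :
    WAllCornerFTwoRamifiedThetaFour :=
  fun W _ _ hcm hr1 hram _ ↦ h W hcm hr1 hram

/-- … of row 12₂ … [folklore] -/
theorem wAllCornerFTwoRamifiedThetaFour_of_wAllCornerFTwo (h : WAllCornerFTwo) : WAllCornerFTwoRamifiedThetaFour :=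
  wAllCornerFTwoRamifiedThetaFour_of_wAllCornerFTwoRamified (wAllCornerFTwo_iff_slices.1 h).2.2.1

/-- … and so is the residual off the four-prime family. [folklore] -/
theorem wAllCornerFTwoRamifiedOffBookedIsogenyOffThetaFour_of_wAllCornerFTwoRamified (h : WAllCornerFTwoRamified) :
    WAllCornerFTwoRamifiedOffBookedIsogenyOffThetaFour :=
  fun W _ _ hcm hr1 hram _ _ _ ↦ h W hcm hr1 hram

/-- **Row 12₂ with the ramified slice cut four ways in isogeny-class currency**: `WAllCornerFTwo` ⟺ split-good ∧
split-bad ∧ (booked-isogeny ∧ Shu–Zhai `256c1` ∧ four-prime theta ∧ residual) ∧ inert-good ∧ inert-bad. [folklore] -/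
theorem wAllCornerFTwo_iff_slices_bookedIsogeny_shuZhai_thetaFour_off :
    WAllCornerFTwo ↔ WAllCornerFTwoSplitGood ∧ WAllCornerFTwoSplitBad ∧
      (WAllCornerFTwoRamifiedBookedIsogeny ∧ WAllCornerFTwoRamifiedShuZhaiTwoFiftySix ∧
        WAllCornerFTwoRamifiedThetaFour ∧ WAllCornerFTwoRamifiedOffBookedIsogenyOffThetaFour) ∧
      WAllCornerFTwoInertGood ∧ WAllCornerFTwoInertBad := by
  rw [wAllCornerFTwo_iff_slices, wAllCornerFTwoRamified_iff_bookedIsogeny_shuZhai_thetaFour_off]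

end Summit.BirchSwinnertonDyer

end
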